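import Mathlib
import Summits.Ventures.PercRepro2.Defs
import Summits.Ventures.PercRepro2.Graph

/-!
# The merged graph `G / (a₂ = a₃)` (blind cell PercRepro2, typer-1)

For the union-cluster reduction of R2′ at `|A| = 3` (`proofs/LEAD-PROOFSHAPES.md` §8.9 and its
addenda) the two non-minimisers `a₂, a₃` are merged into one vertex: `mergeEnds ends a₃ a₂`
redirects every edge end at `a₃` to `a₂` (same edge type, same configuration space, same
measure), so `a₃` becomes isolated and `a₂` plays the role of the merged vertex `â`.

Connectivity (for `a₂ ≠ a₃`, `x, y ≠ a₃`, and `Ũ = C(a₂) ∪ C(a₃)` the union cluster in `G`):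

* `conn_merge_iff`:  `x ↔′ y ↔ x ↔ y ∨ (x ∈ Ũ ∧ y ∈ Ũ)`;
* `mem_cluster_merge_iff`:  `C′(a₂) = Ũ` (away from the isolated vertex `a₃`);
* `conn_merge_iff_of_notMem`:  for `x ∉ Ũ`, `x ↔′ y ↔ x ↔ y` (e.g. `a* ↔′ b ↔ a* ↔ b` on
  `{a* ∉ Ũ}`).
-/

namespace Summit.Ventures.PercRepro2

section Merge

variable {V : Type*} {E : Type*} [DecidableEq V]

/-- The merge map: send `a₃` to `a₂`, fix every other vertex. -/
def mergeVertex (a₃ a₂ : V) : V → V := fun v => if v = a₃ then a₂ else v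

/-- `mergeVertex` at `a₃`. -/
@[simp] lemma mergeVertex_self (a₃ a₂ : V) : mergeVertex a₃ a₂ a₃ = a₂ := by
  simp [mergeVertex]

/-- `mergeVertex` away from `a₃`. -/
lemma mergeVertex_of_ne {a₃ a₂ v : V} (h : v ≠ a₃) : mergeVertex a₃ a₂ v = v := by
  simp [mergeVertex, h]

/-- For `a₂ ≠ a₃` the merge map never returns `a₃`. -/
lemma mergeVertex_ne {a₃ a₂ : V} (h : a₂ ≠ a₃) (v : V) : mergeVertex a₃ a₂ v ≠ a₃ := by
  by_cases hv : v = a₃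
  · subst hv; simpa using h
  · rw [mergeVertex_of_ne hv]; exact hv

/-- The merged graph `G / (a₂ = a₃)`: every edge end at `a₃` is redirected to `a₂`. -/
def mergeEnds (ends : E → Sym2 V) (a₃ a₂ : V) : E → Sym2 V :=
  fun e => (ends e).map (mergeVertex a₃ a₂)

/-- The ends of an edge in the merged graph. -/
lemma mergeEnds_apply {ends : E → Sym2 V} (a₃ a₂ : V) {e : E} {x y : V}
    (h : ends e = s(x, y)) :
    mergeEnds ends a₃ a₂ e = s(mergeVertex a₃ a₂ x, mergeVertex a₃ a₂ y) := by
  simp [mergeEnds, h]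

/-- The union cluster `Ũ = C(a₂) ∪ C(a₃)` of `G`. -/
def unionCluster (ends : E → Sym2 V) (ω : Config E) (a₂ a₃ : V) : Set V :=
  cluster ends ω a₂ ∪ cluster ends ω a₃

omit [DecidableEq V] in
/-- Membership in the union cluster. -/
lemma mem_unionCluster {ends : E → Sym2 V} {ω : Config E} {a₂ a₃ x : V} :
    x ∈ unionCluster ends ω a₂ a₃ ↔ Conn ends ω a₂ x ∨ Conn ends ω a₃ x := Iff.rfl

omit [DecidableEq V] in
/-- `a₂ ∈ Ũ`. -/
lemma left_mem_unionCluster (ends : E → Sym2 V) (ω : Config E) (a₂ a₃ : V) :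
    a₂ ∈ unionCluster ends ω a₂ a₃ :=
  Or.inl (conn_refl ends ω a₂)

omit [DecidableEq V] in
/-- `a₃ ∈ Ũ`. -/
lemma right_mem_unionCluster (ends : E → Sym2 V) (ω : Config E) (a₂ a₃ : V) :
    a₃ ∈ unionCluster ends ω a₂ a₃ :=
  Or.inr (conn_refl ends ω a₃)

omit [DecidableEq V] in
/-- `Ũ` is closed under connection in `G`. -/
lemma mem_unionCluster_of_conn {ends : E → Sym2 V} {ω : Config E} {a₂ a₃ x y : V}
    (hx : x ∈ unionCluster ends ω a₂ a₃) (h : Conn ends ω x y) :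
    y ∈ unionCluster ends ω a₂ a₃ := by
  rcases hx with hx | hx
  · exact Or.inl (conn_trans hx h)
  · exact Or.inr (conn_trans hx h)

/-- Open adjacency is transported to the merged graph. -/
lemma openAdj_merge_of_openAdj {ends : E → Sym2 V} {ω : Config E} (a₃ a₂ : V) {u v : V}
    (h : OpenAdj ends ω u v) :
    OpenAdj (mergeEnds ends a₃ a₂) ω (mergeVertex a₃ a₂ u) (mergeVertex a₃ a₂ v) := by
  obtain ⟨e, he, hends⟩ := h
  exact ⟨e, he, mergeEnds_apply a₃ a₂ hends⟩

/-- Connection is transported to the merged graph. -/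
lemma conn_merge_of_conn {ends : E → Sym2 V} {ω : Config E} (a₃ a₂ : V) {u v : V}
    (h : Conn ends ω u v) :
    Conn (mergeEnds ends a₃ a₂) ω (mergeVertex a₃ a₂ u) (mergeVertex a₃ a₂ v) := by
  have key : v ∈ {z | Conn (mergeEnds ends a₃ a₂) ω (mergeVertex a₃ a₂ u) (mergeVertex a₃ a₂ z)} := by
    refine mem_of_conn_of_closed (ends := ends) (ω := ω) ?_ (conn_refl _ _ _) h
    intro z hz w hzw
    obtain ⟨_, hadj⟩ := openGraph_adj.1 hzw
    exact conn_trans hz (conn_of_openAdj (openAdj_merge_of_openAdj a₃ a₂ hadj))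
  exact key

/-- The vertices of the merged graph adjacent to something are never `a₃` (`a₂ ≠ a₃`). -/
lemma ne_of_openAdj_merge {ends : E → Sym2 V} {ω : Config E} {a₃ a₂ : V} (h23 : a₂ ≠ a₃)
    {z w : V} (h : OpenAdj (mergeEnds ends a₃ a₂) ω z w) : z ≠ a₃ ∧ w ≠ a₃ := by
  obtain ⟨e, _, hends⟩ := h
  induction hu : ends e using Sym2.ind with
  | h x y =>
    rw [mergeEnds_apply a₃ a₂ hu, Sym2.eq_iff] at hends
    rcases hends with ⟨rfl, rfl⟩ | ⟨rfl, rfl⟩ <;>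
      exact ⟨mergeVertex_ne h23 _, mergeVertex_ne h23 _⟩

/-- **Connectivity of the merged graph**: for `a₂ ≠ a₃` and `x, y ≠ a₃`,
`x ↔′ y ↔ x ↔ y ∨ (x ∈ Ũ ∧ y ∈ Ũ)` with `Ũ = C(a₂) ∪ C(a₃)`. -/
theorem conn_merge_iff {ends : E → Sym2 V} {ω : Config E} {a₂ a₃ : V} (h23 : a₂ ≠ a₃) {x y : V}
    (hx : x ≠ a₃) (hy : y ≠ a₃) :
    Conn (mergeEnds ends a₃ a₂) ω x y ↔
      Conn ends ω x y ∨ (x ∈ unionCluster ends ω a₂ a₃ ∧ y ∈ unionCluster ends ω a₂ a₃) := by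
  constructor
  · intro h
    -- the invariant `Conn x z ∨ (x ∈ Ũ ∧ z ∈ Ũ)` is closed under merged adjacency
    have key : y ∈ {z | Conn ends ω x z ∨
        (x ∈ unionCluster ends ω a₂ a₃ ∧ z ∈ unionCluster ends ω a₂ a₃)} := by
      refine mem_of_conn_of_closed (ends := mergeEnds ends a₃ a₂) (ω := ω) ?_
        (Or.inl (conn_refl ends ω x)) h
      intro z hz w hzw
      obtain ⟨_, hadj⟩ := openGraph_adj.1 hzw
      obtain ⟨hz3, hw3⟩ := ne_of_openAdj_merge h23 hadj
      obtain ⟨e, he, hends⟩ := hadj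
      -- the original ends of `e`
      induction hu : ends e using Sym2.ind with
      | h u v =>
        rw [mergeEnds_apply a₃ a₂ hu, Sym2.eq_iff] at hends
        -- `xU`: whenever `z ∈ Ũ` the invariant at `z` puts `x ∈ Ũ`
        have xU : z ∈ unionCluster ends ω a₂ a₃ → x ∈ unionCluster ends ω a₂ a₃ := by
          intro hzU
          rcases hz with hz | hz
          · exact mem_unionCluster_of_conn hzU (conn_symm hz)
          · exact hz.1
        -- the two orientations of the edge
        have step : ∀ u v : V, ends e = s(u, v) → mergeVertex a₃ a₂ u = z →
            mergeVertex a₃ a₂ v = w →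
            Conn ends ω x w ∨
              (x ∈ unionCluster ends ω a₂ a₃ ∧ w ∈ unionCluster ends ω a₂ a₃) := by
          intro u v huv hzu hwv
          by_cases hu3 : u = a₃
          · -- `z = a₂`
            have hz2 : z = a₂ := by rw [← hzu, hu3, mergeVertex_self]
            by_cases hv3 : v = a₃
            · have hw2 : w = a₂ := by rw [← hwv, hv3, mergeVertex_self]
              rw [show w = z by rw [hw2, hz2]]
              exact hz
            · -- the edge `e = {a₃, v}` puts `v ∈ Ũ`
              have hwv' : w = v := by rw [← hwv, mergeVertex_of_ne hv3]
              have hvU : v ∈ unionCluster ends ω a₂ a₃ :=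
                Or.inr (conn_of_openAdj ⟨e, he, by rw [huv, hu3]⟩)
              have hzU : z ∈ unionCluster ends ω a₂ a₃ := by
                rw [hz2]; exact left_mem_unionCluster ends ω a₂ a₃
              rw [hwv']
              exact Or.inr ⟨xU hzU, hvU⟩
          · have hzu' : z = u := by rw [← hzu, mergeVertex_of_ne hu3]
            by_cases hv3 : v = a₃
            · -- `w = a₂`, the edge `e = {z, a₃}` puts `z ∈ Ũ`
              have hw2 : w = a₂ := by rw [← hwv, hv3, mergeVertex_self]
              have hzU : z ∈ unionCluster ends ω a₂ a₃ := by
                rw [hzu']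
                exact Or.inr (conn_of_openAdj (OpenAdj.symm ⟨e, he, by rw [huv, hv3]⟩))
              rw [hw2]
              exact Or.inr ⟨xU hzU, left_mem_unionCluster ends ω a₂ a₃⟩
            · have hwv' : w = v := by rw [← hwv, mergeVertex_of_ne hv3]
              have hzw' : Conn ends ω z w := by
                rw [hzu', hwv']
                exact conn_of_openAdj ⟨e, he, huv⟩
              rcases hz with hz | hz
              · exact Or.inl (conn_trans hz hzw')
              · exact Or.inr ⟨hz.1, mem_unionCluster_of_conn hz.2 hzw'⟩
        rcases hends with ⟨hzu, hwv⟩ | ⟨hwv, hzu⟩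
        · exact step u v hu hzu hwv
        · exact step v u (by rw [hu, Sym2.eq_swap]) hzu hwv
    exact key
  · rintro (h | ⟨hxU, hyU⟩)
    · have := conn_merge_of_conn a₃ a₂ h
      rwa [mergeVertex_of_ne hx, mergeVertex_of_ne hy] at this
    · -- both `x` and `y` are merged-connected to `a₂`
      have toA : ∀ z : V, z ≠ a₃ → z ∈ unionCluster ends ω a₂ a₃ →
          Conn (mergeEnds ends a₃ a₂) ω a₂ z := by
        intro z hz hzU
        rcases hzU with hzU | hzU
        · have := conn_merge_of_conn a₃ a₂ hzU
          rwa [mergeVertex_of_ne h23, mergeVertex_of_ne hz] at this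
        · have := conn_merge_of_conn a₃ a₂ hzU
          rwa [mergeVertex_self, mergeVertex_of_ne hz] at this
      exact conn_trans (conn_symm (toA x hx hxU)) (toA y hy hyU)

/-- **The merged cluster of `a₂` is the union cluster** (away from the isolated vertex `a₃`):
for `y ≠ a₃`, `y ∈ C′(a₂) ↔ y ∈ Ũ`. -/
theorem mem_cluster_merge_iff {ends : E → Sym2 V} {ω : Config E} {a₂ a₃ : V} (h23 : a₂ ≠ a₃)
    {y : V} (hy : y ≠ a₃) :
    y ∈ cluster (mergeEnds ends a₃ a₂) ω a₂ ↔ y ∈ unionCluster ends ω a₂ a₃ := by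
  rw [mem_cluster, conn_merge_iff h23 h23 hy]
  constructor
  · rintro (h | ⟨_, h⟩)
    · exact Or.inl h
    · exact h
  · intro h
    exact Or.inr ⟨left_mem_unionCluster ends ω a₂ a₃, h⟩

/-- **Connections from outside the union cluster are unchanged**: for `x ∉ Ũ` (and
`x, y ≠ a₃`), `x ↔′ y ↔ x ↔ y`. -/
theorem conn_merge_iff_of_notMem {ends : E → Sym2 V} {ω : Config E} {a₂ a₃ : V} (h23 : a₂ ≠ a₃)
    {x y : V} (hx : x ≠ a₃) (hy : y ≠ a₃) (hxU : x ∉ unionCluster ends ω a₂ a₃) :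
    Conn (mergeEnds ends a₃ a₂) ω x y ↔ Conn ends ω x y := by
  rw [conn_merge_iff h23 hx hy]
  exact ⟨fun h => h.elim id fun h' => (hxU h'.1).elim, Or.inl⟩

/-- The isolated vertex: in the merged graph `a₃` is connected to nothing else (`a₂ ≠ a₃`). -/
lemma conn_merge_self_iff {ends : E → Sym2 V} {ω : Config E} {a₂ a₃ : V} (h23 : a₂ ≠ a₃)
    {y : V} : Conn (mergeEnds ends a₃ a₂) ω a₃ y ↔ y = a₃ := by
  constructor
  · intro h
    have key : y ∈ {z | z = a₃} := by
      refine mem_of_conn_of_closed (ends := mergeEnds ends a₃ a₂) (ω := ω) ?_ rfl h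
      intro z hz w hzw
      obtain ⟨_, hadj⟩ := openGraph_adj.1 hzw
      exact ((ne_of_openAdj_merge h23 hadj).1 hz).elim
    exact key
  · rintro rfl
    exact conn_refl _ _ _

end Merge

end Summit.Ventures.PercRepro2
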